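import Summits.ResolutionOfSingularities.ResolutionOfSingularities.Theorems.FrobeniusLadderFInjectiveMacaulayficationOfTrRungs
import Summits.ResolutionOfSingularities.ResolutionOfSingularities.Theorems.FrobeniusLadderFInjectiveMacaulayficationLRadmIffTr
import Mathlib.RingTheory.MvPolynomial.Localization
import Mathlib.RingTheory.Localization.LocalizationLocalization
import HarnessLib

/-!
# TRANSCENDENCE MONOTONICITY of the level-`e` rung `ClosedPointLocalResolutionAdmTr p e r`, and the v38 resolution stub at `r = 1`
# (crux `FInjectiveMacaulayfication` stmt-ResolutionOfSingularities-15315, chain w45a, door v38 «closed-point door» `4c41af8f694fab1a`;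
# seat res-L1-w45a-lead-1 g8, own object 2)

[OURS · L1 W4.5a] Support file (`--supports stmt-ResolutionOfSingularities-15315 --as helper`); replaces the role of NO printed item; NOT a
statement of any manuscript; def-free; AI-written (AI review is weaker than expert review).

Door v38's resolution-side research stub is `∀ p e r, p.Prime → 4 ≤ e → 1 ≤ r → ClosedPointLocalResolutionAdmTr p e r` (res-L1-w45a-stub-3
p602502): closed-point admissible local resolution of `e`-folds over the purely transcendental fields `k(s₁,…,s_r)`, ALL `r ≥ 1`, all fields
`k` of characteristic `p`. This file shows that the level `r` is MONOTONE and hence that `r = 1` ALONE carries the stub: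

* §1 `nonempty_ringEquiv_fractionRing_tower k j r` — the tower isomorphism of purely transcendental extensions
  `k′(s₁,…,s_j) ≅ k(s₁,…,s_{j+r})` with `k′ := k(t₁,…,t_r) = FractionRing (MvPolynomial (Fin r) k)` (itself a field of characteristic `p`,
  `NonClosedPointChart.charP_fractionRing_mvPolynomial`): `k′[s] = MvPolynomial (Fin j) k′` is the localisation of `k[t][s]` at the non-zero
  constants of `k[t]` (Mathlib `MvPolynomial.isLocalization`), so `Frac(k[t][s])` is a fraction field of `k′[s]`
  (`IsFractionRing.isFractionRing_of_isDomain_of_isLocalization`), and `k[t][s] ≅ k[s ⊔ t]` (`MvPolynomial.sumAlgEquiv`, `renameEquiv finSumFinEquiv`).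
* §2 ★ `closedPointLocalResolutionAdmTr_mono : ClosedPointLocalResolutionAdmTr p e j → ClosedPointLocalResolutionAdmTr p e (j + r)` — a
  finite-type separated `e`-fold over `k(s₁,…,s_{j+r})` IS one over `k′(s₁,…,s_j)` along `Spec` of the tower isomorphism; every other binder of
  the rung (integrality, dimension, the closed point, the local blow-up, admissibility, the fibre clause, the conclusion) lives on `Y` alone.
* §3 COROLLARIES: `forall_tr_iff_tr_one` (`(∀ r ≥ 1, T p e r) ↔ T p e 1`); ★★ `stubTr_iff_tr_one` — door v38's registered stub
  `stub_closedPointLocalResolutionAdmTr` is EQUIVALENT to **`∀ p e, p.Prime → 4 ≤ e → ClosedPointLocalResolutionAdmTr p e 1`**: closed-point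
  admissible local uniformization of `e`-folds, `e ≥ 4`, over `k(s)` — ONE transcendental — for every field `k` of characteristic `p`;
  `localResolutionNonClosedGe4Adm_iff_tr_one` ((LR_adm) ⟺ the same, through stub-3's iff p604770); and the by-name door theorem
  `fInjectiveMacaulayfication_of_trOne_of_cesnaviciusOffClosed` (crux ⟸ four published theorems ∧ the `r = 1` rungs ∧ the F-half).

REMARK for the per-`d`-fold slices (stub-3 g9 item 1, «r + e ≤ dim X»): by monotonicity the INEQUALITY form consumes nothing less than
`T(p, e, 1)` for `4 ≤ e ≤ d − 1`; only the EXACT count `r = trdeg_k κ(x) = dim X − dim 𝒪_{X,x}` (dimension formula) gives the genuinely weaker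
per-`d` residue `{T(p, e, d − e) : 4 ≤ e ≤ d − 1}` (`d = 5`: `T(p,4,1)`; `d = 6`: `T(p,4,2) ∧ T(p,5,1)`), since `T(p,e,r)` WEAKENS as `r` grows.

[folklore; cite: Temkin2008, Prop. 2.3.4 (iii); EGAIV2, §6 (generic fibres)] [cite: Matsumura1987, §33 Lemma 2]
-/

-- single-problem summit: the doubled namespace component is forced
set_option linter.dupNamespace false

noncomputable section

namespace Summit.ResolutionOfSingularities.ResolutionOfSingularities.Theorems.FInjectiveMacaulayfication.ClosedPointLocalResolutionAdmTrMono

open CategoryTheory AlgebraicGeometry TopologicalSpace IsLocalRing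
open Literature.AlgebraicGeometry.Resolution
open Summit.ResolutionOfSingularities.ResolutionOfSingularities.Theorems.FInjectiveMacaulayfication
open ClosedPointLocalResolutionAdmTr

/-! ## §1 The tower isomorphism `k(t₁..t_r)(s₁..s_j) ≅ k(s₁..s_j, t₁..t_r)` -/

/-- **`Frac (k(t₁,…,t_r)[s₁,…,s_j]) ≅ Frac (k[s₁,…,s_j,t₁,…,t_r])`**: the purely transcendental extension in `j + r` variables of `k` is
the purely transcendental extension in `j` variables of `k′ = k(t₁,…,t_r)`. Proof: `k′[s]` is the localisation of `k[t][s]` at the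
non-zero constants (`MvPolynomial.isLocalization`), hence has the same fraction field (`IsFractionRing.isFractionRing_of_isDomain_of_isLocalization`),
and `k[t][s] ≅ k[s ⊔ t] ≅ k[Fin (j + r)]` (`MvPolynomial.sumAlgEquiv`, `MvPolynomial.renameEquiv finSumFinEquiv`). [folklore] -/
theorem nonempty_ringEquiv_fractionRing_tower (k : Type) [Field k] (j r : ℕ) :
    Nonempty (FractionRing (MvPolynomial (Fin j) (FractionRing (MvPolynomial (Fin r) k))) ≃+*
      FractionRing (MvPolynomial (Fin (j + r)) k)) := by
  classical
  -- `A = k[t]`, `k′ = Frac A`, `B = k′[s]`, `A″ = A[s]`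
  letI : Algebra (MvPolynomial (Fin j) (MvPolynomial (Fin r) k)) (MvPolynomial (Fin j) (FractionRing (MvPolynomial (Fin r) k))) :=
    MvPolynomial.algebraMvPolynomial
  haveI hloc : IsLocalization ((nonZeroDivisors (MvPolynomial (Fin r) k)).map (MvPolynomial.C (σ := Fin j)))
      (MvPolynomial (Fin j) (FractionRing (MvPolynomial (Fin r) k))) :=
    MvPolynomial.isLocalization _ _
  -- the non-zero constants of `A[s]` become units in `Frac (A[s])`
  have hunits : ∀ y : (nonZeroDivisors (MvPolynomial (Fin r) k)).map (MvPolynomial.C (σ := Fin j)),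
      IsUnit (algebraMap (MvPolynomial (Fin j) (MvPolynomial (Fin r) k)) (FractionRing (MvPolynomial (Fin j) (MvPolynomial (Fin r) k))) y) := by
    rintro ⟨y, hy⟩
    obtain ⟨a, ha, rfl⟩ := hy
    have hCa : (MvPolynomial.C (σ := Fin j) a : MvPolynomial (Fin j) (MvPolynomial (Fin r) k)) ≠ 0 := fun h =>
      nonZeroDivisors.ne_zero ha ((MvPolynomial.C_injective (Fin j) (MvPolynomial (Fin r) k)) (by rw [h, MvPolynomial.C_0]))
    exact IsLocalization.map_units (FractionRing (MvPolynomial (Fin j) (MvPolynomial (Fin r) k)))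
      (⟨MvPolynomial.C a, mem_nonZeroDivisors_of_ne_zero hCa⟩ : nonZeroDivisors (MvPolynomial (Fin j) (MvPolynomial (Fin r) k)))
  -- `Frac (A[s])` as a `k′[s]`-algebra through the universal property of the localisation `A[s] → k′[s]`
  letI : Algebra (MvPolynomial (Fin j) (FractionRing (MvPolynomial (Fin r) k))) (FractionRing (MvPolynomial (Fin j) (MvPolynomial (Fin r) k))) :=
    (IsLocalization.lift (M := (nonZeroDivisors (MvPolynomial (Fin r) k)).map (MvPolynomial.C (σ := Fin j)))
      (S := MvPolynomial (Fin j) (FractionRing (MvPolynomial (Fin r) k))) hunits).toAlgebra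
  haveI : IsScalarTower (MvPolynomial (Fin j) (MvPolynomial (Fin r) k)) (MvPolynomial (Fin j) (FractionRing (MvPolynomial (Fin r) k)))
      (FractionRing (MvPolynomial (Fin j) (MvPolynomial (Fin r) k))) :=
    IsScalarTower.of_algebraMap_eq fun x =>
      (IsLocalization.lift_eq (M := (nonZeroDivisors (MvPolynomial (Fin r) k)).map (MvPolynomial.C (σ := Fin j)))
        (S := MvPolynomial (Fin j) (FractionRing (MvPolynomial (Fin r) k))) hunits x).symm
  haveI : IsFractionRing (MvPolynomial (Fin j) (FractionRing (MvPolynomial (Fin r) k)))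
      (FractionRing (MvPolynomial (Fin j) (MvPolynomial (Fin r) k))) :=
    IsFractionRing.isFractionRing_of_isDomain_of_isLocalization
      ((nonZeroDivisors (MvPolynomial (Fin r) k)).map (MvPolynomial.C (σ := Fin j))) _ _
  -- assemble: `Frac (k′[s]) ≅ Frac (A[s]) ≅ Frac (k[Fin (j + r)])`
  let φ₁ : FractionRing (MvPolynomial (Fin j) (FractionRing (MvPolynomial (Fin r) k))) ≃ₐ[MvPolynomial (Fin j) (FractionRing (MvPolynomial (Fin r) k))]
      FractionRing (MvPolynomial (Fin j) (MvPolynomial (Fin r) k)) :=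
    FractionRing.algEquiv (MvPolynomial (Fin j) (FractionRing (MvPolynomial (Fin r) k))) _
  let e : MvPolynomial (Fin j) (MvPolynomial (Fin r) k) ≃+* MvPolynomial (Fin (j + r)) k :=
    ((MvPolynomial.sumAlgEquiv k (Fin j) (Fin r)).symm.trans (MvPolynomial.renameEquiv k finSumFinEquiv)).toRingEquiv
  let φ₂ : FractionRing (MvPolynomial (Fin j) (MvPolynomial (Fin r) k)) ≃+* FractionRing (MvPolynomial (Fin (j + r)) k) :=
    IsFractionRing.ringEquivOfRingEquiv e
  exact ⟨φ₁.toRingEquiv.trans φ₂⟩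

/-! ## §2 Monotonicity in the transcendence level -/

/-- ★ **TRANSCENDENCE MONOTONICITY**: `ClosedPointLocalResolutionAdmTr p e j → ClosedPointLocalResolutionAdmTr p e (j + r)`. An integral
separated finite-type `e`-fold over `k(s₁,…,s_{j+r})` is one over `k′(s₁,…,s_j)` for the field `k′ = k(t₁,…,t_r)` of characteristic `p`
(compose the structure map with `Spec` of the tower isomorphism of §1, an isomorphism of schemes); the closed point, the local blow-up, its
admissibility, the fibre clause and the conclusion `AdmitsDesingularization` do not mention the ground field. [folklore] -/
theorem closedPointLocalResolutionAdmTr_mono {p e j : ℕ} (h : ClosedPointLocalResolutionAdmTr p e j) (r : ℕ) :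
    ClosedPointLocalResolutionAdmTr p e (j + r) := by
  intro k _ _ Y g hs hl hq hi hd y hy S' g' I hg' hI hfib
  obtain ⟨φ⟩ := nonempty_ringEquiv_fractionRing_tower k j r
  haveI := NonClosedPointChart.charP_fractionRing_mvPolynomial p k r
  -- `Spec` of the tower isomorphism
  let ι : Spec (.of (FractionRing (MvPolynomial (Fin (j + r)) k))) ⟶
      Spec (.of (FractionRing (MvPolynomial (Fin j) (FractionRing (MvPolynomial (Fin r) k))))) :=
    Spec.map φ.toCommRingCatIso.hom
  haveI : IsIso ι := inferInstance
  haveI := hs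
  haveI := hl
  haveI := hq
  exact h (FractionRing (MvPolynomial (Fin r) k)) Y (g ≫ ι) inferInstance inferInstance inferInstance hi hd y hy S' g' I hg' hI hfib

/-! ## §3 The v38 resolution stub at `r = 1` -/

/-- **All levels `r ≥ 1` ⟺ the level `r = 1`** (at fixed `p`, `e`). [folklore] -/
theorem forall_tr_iff_tr_one {p e : ℕ} :
    (∀ r : ℕ, 1 ≤ r → ClosedPointLocalResolutionAdmTr p e r) ↔ ClosedPointLocalResolutionAdmTr p e 1 := by
  refine ⟨fun h => h 1 le_rfl, fun h r hr => ?_⟩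
  obtain ⟨r₀, rfl⟩ := Nat.exists_eq_add_of_le hr
  exact closedPointLocalResolutionAdmTr_mono h r₀

/-- ★★ **Door v38's registered resolution stub `stub_closedPointLocalResolutionAdmTr` ⟺ its `r = 1` case**: closed-point admissible local
resolution of `e`-folds, `e ≥ 4`, over `k(s)` — ONE transcendental — for every field `k` of characteristic `p`. [OURS · reduction; folklore] -/
theorem stubTr_iff_tr_one :
    (∀ p e r : ℕ, p.Prime → 4 ≤ e → 1 ≤ r → ClosedPointLocalResolutionAdmTr p e r) ↔
      ∀ p e : ℕ, p.Prime → 4 ≤ e → ClosedPointLocalResolutionAdmTr p e 1 :=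
  ⟨fun h p e hp he => h p e 1 hp he le_rfl,
    fun h p e r hp he hr => forall_tr_iff_tr_one.mpr (h p e hp he) r hr⟩

/-- **(LR_adm) ⟺ the `r = 1` rungs at all levels `e ≥ 4`** (through res-L1-w45a-stub-3's `LRadmIffTr.localResolutionNonClosedGe4Adm_iff_tr`):
local resolution of admissible fibre-singular blow-ups at NON-closed points of local dimension `≥ 4` of varieties over fields of characteristic
`p` is equivalent to closed-point admissible local resolution of `e`-folds (`e ≥ 4`) over the fields `k(s)`. [OURS · reduction; folklore]
[cite: EGAIV3, (8.8.2); Temkin2008, Prop. 2.3.4 (iii)] -/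
theorem localResolutionNonClosedGe4Adm_iff_tr_one :
    RegularOffFiniteOfLRAdm.LocalResolutionNonClosedGe4Adm ↔
      ∀ p e : ℕ, p.Prime → 4 ≤ e → ClosedPointLocalResolutionAdmTr p e 1 :=
  LRadmIffTr.localResolutionNonClosedGe4Adm_iff_tr.trans stubTr_iff_tr_one

/-- **★ THE ROUTE DECL ⟸ {CP 2019 Thm 1.1, Stacks 081R, CP 2019 Prop 4.4, Česnavičius 2021 Thm 5.3 (reading (B)) BY NAME} ∧ the `r = 1` rungs
(`e ≥ 4`) ∧ the F-half** — door v38's `_proof` term with the resolution stub at one transcendental. [OURS · conditional-result: conditional on four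
published theorems BY NAME and on the CANDIDATE statements] [cite: Cesnavicius2021, Thm. 5.3] [cite: CossartPiltant2019, Thm. 1.1 (i)(ii); Prop. 4.4]
[cite: RaynaudGruson1971, Thm. 5.2.2] [cite: Temkin2008, Prop. 2.3.4 (iii)] -/
theorem fInjectiveMacaulayfication_of_trOne_of_cesnaviciusOffClosed
    (hG : CossartPiltant2019General.{0}) (h081R : Stacks081R.{0}) (hP : CossartPiltant2019Principalization.{0})
    (hM : CesnaviciusBlowupMacaulayficationOffClosed.{0})
    (hR : ∀ p e : ℕ, p.Prime → 4 ≤ e → ClosedPointLocalResolutionAdmTr p e 1)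
    (hF : LocalFullificationFibreAdmGe4Split.LocalFInjectivizationFibreAdmGe4) :
    Summit.ResolutionOfSingularities.ResolutionOfSingularities.Theses.FrobeniusLadder.FInjectiveMacaulayfication :=
  OfTrRungs.fInjectiveMacaulayfication_of_trRungs_of_cesnaviciusOffClosed hG h081R hP hM (stubTr_iff_tr_one.mpr hR) hF

end Summit.ResolutionOfSingularities.ResolutionOfSingularities.Theorems.FInjectiveMacaulayfication.ClosedPointLocalResolutionAdmTrMono

end
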